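import Summits.QuantumFields.YangMills.Theorems.UnitScaleTiltHalvingCompetitorMapFibreSmooth
import Summits.QuantumFields.YangMills.Theorems.UnitScaleTiltHalvingCompetitorMapFibreStat
import Summits.QuantumFields.YangMills.Theorems.UnitScaleTiltHalvingCompetitorRegularOpen
import HarnessLib

/-!
# Route `UnitScaleTilt`, crux K1 child «MinimiserStabilityRegPr» (stmt-QuantumFields-19200), registered stub `stub_halvingStep` (H), door v3 (Stat currency),
# row B5 «DIFFERENTIABLE GAUGE FIX» (LEAD ★w5-19200 g4 RULING L-7 (a)), the row ASSEMBLED — **STAT AT THE MINIMISER ⟹ THE WILSON ACTION IS STATIONARY ALONG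
# EVERY COMPETITOR LINE OF THE CHART**: in the letters of ✓B4 `exists_gaugeAct_mem_fibre_of_chart49` + the line data of ✓file C, door v3's first-order clause at
# `Umin` gives `deriv (t ↦ 𝒲(W_t)) 0 = 0` — the `hstat` input of the FILE A twin ✓`HalvingDressedStationaritySU2.tracePairing_of_derivZero_localChart` at one direction

Cell `ym3-torus` (HUMAN RULING D-0037, YM ladder rung R3 — continuum SU(2) YM₃ on the torus is a RUNG, not the Clay problem), width seat `ym-ust-19200-w1` gen 8.
`--supports stmt-QuantumFields-19200 --as helper`; def-free, 0 sorry, standard axioms; counts toward nothing by itself.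

THE CHAIN (every arrow landed).  ✓file C `exists_smoothGauge_mem_fibre_of_chart49_line`: an `SU(2)` gauge family `h_t` with `h_t • W_t ∈ 𝔅_k(V)` for regular `W_t`, `|t| < r`,
and `t ↦ ↑(h_t z)`, `t ↦ ↑(W_t b)` differentiable on `|t₀| < r`; `W_0 = uS • Umin` (the chart identity `hchartNear` on `Near`, `hWfar` off it) is regular
(✓`regPr_gaugeAct_of_mem_regFibrePr`), so `W_t` is regular for `|t| < r′` (✓`Prop7CritEL.isOpen_regPr` + continuity from differentiability); ✓file Stat
`deriv_wilsonAction_line_eq_zero_of_stat` on `|t| < min r r′`.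

WHAT IS PROVED (ns `…Theorems.HalvingCompetitorMapFibreSmoothStat`).
* ★★ `exists_gaugeFamily_chartLine` — file C's binder list + `0 < r` ⟹ `∃ r′ > 0, ∃ h : ℝ → GaugeTransf …, (∀ t, |t| < r′ → h t • Wl t ∈ 𝔅_k(V)) ∧ (∀ x, DifferentiableAt ℝ
  (t ↦ ↑(h t x)) 0) ∧ (∀ b, DifferentiableAt ℝ (t ↦ ↑(Wl t b)) 0)` — the UNCONDITIONAL line form = ★w7-19200 g1's displayed binder (G) `hgauge` of L2‴∕L3″ at one direction
  (file C's clause 1 on `|t| < min r r_reg`, `r_reg` the regular radius of the line).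
* ★★★ `deriv_wilsonAction_chartLine_eq_zero_of_stat` — file C's binder list + `0 < r` + `hstat` (door v3's clause at `Umin`, ✓`Prop7StubEXOfChartPiecesTwSL` :179–182 letters with
  `γ 0 = Umin`) ⟹ `deriv (fun t => wilsonAction4 (Wl t)) 0 = 0`.  In L2″'s letters: `Wl t := Φloc (A + t • (s•Et))`, `s ∈ ker QE`, `Et` self-adjoint traceless — the L2‴ writer's
  replacement for `hminΦ` (one call per direction; `hYQ` from `QE s = 0`, `r` from ✓`exists_lineRadius_of_mem_weightedBall`, `hWnear` from `hUc` + `dressed_competitor_su2`).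
HONEST SCOPE: assembly; the two `Near` containment clauses, the minimiser's membership, the chart identity and `hDd` are displayed as in B4∕L2″; nothing of print is asserted;
NOT a claim about the stub, the crux, the rung or a mass gap.

References: T. Bałaban, CMP **102** (1985) 277–309 [Balaban1985Variational] ((3)–(6) p.278, (44)–(49) p.285, (111) p.294, (150) p.301, (157)–(158) p.302).
-/

set_option autoImplicit false

noncomputable section

open scoped BigOperators Matrix.Norms.L2Operator Topology
open NormedSpace Filter

namespace Summit.QuantumFields.YangMills.Theorems.HalvingCompetitorMapFibreSmoothStat

open Literature.MathematicalPhysics.QuantumFieldTheory.Balaban1983to89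
open Literature.MathematicalPhysics.QuantumFieldTheory.Balaban1983to89.T3ContinuumYM3Torus
open Literature.MathematicalPhysics.QuantumFieldTheory.Balaban1983to89.T3UnitLawDensityEML (ℰp)
open Literature.MathematicalPhysics.QuantumFieldTheory.Balaban1983to89.T3TiltDescent (descendTo)
open Literature.MathematicalPhysics.QuantumFieldTheory.Balaban1983to89.T3ConstrainedMinimiser (fibre)
open Literature.MathematicalPhysics.QuantumFieldTheory.Balaban1983to89.T3PrintedRegularMinimiser (RegPr regFibrePr mem_regFibrePr_iff)
open T4Continuum BlockAveraging
open B5Eq118OneStroke (iterBlockOf)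
open B6SectADomainsV1 (Domains)
open B6SectAOperatorsV1 (BondIdx)
open LatticeFieldCalculus (bondAvgIter)
open FlatCubeOpsText (IsLevWeight)
open Summit.QuantumFields.YangMills.Theorems.Prop8ChartDoubleBar (chartLogFlat)
open Summit.QuantumFields.YangMills.Theorems.Prop7CritEL (isOpen_regPr continuousAt_of_differentiableAt_bonds)
open Summit.QuantumFields.YangMills.Theorems.HalvingCompetitorRegularOpen (regPr_gaugeAct_of_mem_regFibrePr)
open Summit.QuantumFields.YangMills.Theorems.HalvingCompetitorMapFibreSmooth (exists_smoothGauge_mem_fibre_of_chart49_line)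
open Summit.QuantumFields.YangMills.Theorems.HalvingCompetitorMapFibreStat (deriv_wilsonAction_line_eq_zero_of_stat)

variable (F : T3Family) (n K : ℕ)

-- heartbeat budget (HOME README rule): a 40-binder signature; budgeted on this declaration only
set_option maxHeartbeats 400000 in
/-- ★★ **THE UNCONDITIONAL LINE FORM — (G) AT ONE DIRECTION**: file C's gauge family on `|t| < min r r_reg` (`r_reg` the regular radius of the line: `W_0 = uS • Umin` is regular,
✓`isOpen_regPr`, continuity from file C's clause (3)); plus the line's bondwise differentiability at `0`. [cite: Balaban1985Variational, (3)-(6) p.278, (44)-(49) p.285, (150) p.301] -/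
theorem exists_gaugeFamily_chartLine (Dm : Domains (F.P K)) (hDk : Dm.k = K - n)
    (hcollar : ∀ (i : ℕ) (e : PBond (F.P K) (i + 1)), Dm.LamBond (i + 1) e → ∀ z : Site (F.P K) i, (blockOf z = e.src ∨ blockOf z = e.tgt) → z ∈ Dm.Om i)
    {w : ℕ → PBond (F.P K) 0 → ℝ} (hw : IsLevWeight F n K Dm w)
    {R : ℝ} (hR : 16 * 3800 * ((((F.P K).d + 2) * (F.P K).L : ℕ) : ℝ) ^ 2 * (F.L : ℝ) * R ≤ 1)
    (H : (BondIdx Dm → Matrix (Fin 2) (Fin 2) ℂ) →ₗ[ℂ] (PBond (F.P K) 0 → Matrix (Fin 2) (Fin 2) ℂ))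
    (D : (PBond (F.P K) 0 → Matrix (Fin 2) (Fin 2) ℂ) → (BondIdx Dm → Matrix (Fin 2) (Fin 2) ℂ))
    {r₁ : ℝ}
    (h49 : ∀ X : PBond (F.P K) 0 → Matrix (Fin 2) (Fin 2) ℂ, (∀ b, w 1 b * ‖X b‖ < r₁) → (fun (Z : PBond (F.P K) 0 → Matrix (Fin 2) (Fin 2) ℂ) =>
      chartLogFlat ((((F.L : ℝ))⁻¹) ^ (K - n)) Dm Z - (fderiv ℂ (chartLogFlat ((((F.L : ℝ))⁻¹) ^ (K - n)) Dm : (PBond (F.P K) 0 → Matrix (Fin 2) (Fin 2) ℂ) →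
        BondIdx Dm → Matrix (Fin 2) (Fin 2) ℂ) 0) Z) (X - H (D X)) = D X)
    (hHinv : ∀ Y : BondIdx Dm → Matrix (Fin 2) (Fin 2) ℂ, (fderiv ℂ (chartLogFlat ((((F.L : ℝ))⁻¹) ^ (K - n)) Dm : (PBond (F.P K) 0 → Matrix (Fin 2) (Fin 2) ℂ) →
      BondIdx Dm → Matrix (Fin 2) (Fin 2) ℂ) 0) (H Y) = Y)
    (hball : ∀ X : PBond (F.P K) 0 → Matrix (Fin 2) (Fin 2) ℂ, (∀ b, w 1 b * ‖X b‖ < r₁) → ∀ b, w 1 b * ‖(X - H (D X)) b‖ < R)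
    (hDd : ∀ X : PBond (F.P K) 0 → Matrix (Fin 2) (Fin 2) ℂ, (∀ b, w 1 b * ‖X b‖ < r₁) → DifferentiableAt ℂ D X)
    {A : PBond (F.P K) 0 → Matrix (Fin 2) (Fin 2) ℂ} (hAS : ∀ b, w 1 b * ‖A b‖ < r₁)
    {Y : PBond (F.P K) 0 → Matrix (Fin 2) (Fin 2) ℂ} (hYQ : ∀ c : BondIdx Dm, bondAvgIter (c.1.1 : ℕ) Y c.1.2 = 0)
    {r : ℝ} (hr : 0 < r) (hrS : ∀ t : ℝ, |t| < r → ∀ b, w 1 b * ‖(A + t • Y) b‖ < r₁)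
    (hnK : n ≤ K) {ε₀ : ℝ} (hε₀ : 0 < ε₀) (hε : 10 ^ 7 * (F.L : ℝ) ^ 3 * ε₀ ≤ 1)
    {V : GaugeField (F.P n) 0 (Matrix.specialUnitaryGroup (Fin 2) ℂ)} {Umin : GaugeField (F.P K) 0 (Matrix.specialUnitaryGroup (Fin 2) ℂ)}
    (hUmin : Umin ∈ regFibrePr F n K hnK ε₀ V)
    (uS : GaugeTransf (F.P K) 0 (Matrix.specialUnitaryGroup (Fin 2) ℂ))
    (Near : PBond (F.P K) 0 → Prop)
    (hNearIdx : ∀ idx : BondIdx Dm, 1 ≤ (idx.1.1 : ℕ) → ∀ b : PBond (F.P K) 0,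
      (iterBlockOf (idx.1.1 : ℕ) b.src = idx.1.2.src ∨ iterBlockOf (idx.1.1 : ℕ) b.src = idx.1.2.tgt) →
      (iterBlockOf (idx.1.1 : ℕ) b.tgt = idx.1.2.src ∨ iterBlockOf (idx.1.1 : ℕ) b.tgt = idx.1.2.tgt) → Near b)
    (hNearΩ : ∀ (j : ℕ) (z : Site (F.P K) (j + 1)), z ∈ Dm.Om (j + 1) → ∀ b : PBond (F.P K) 0, iterBlockOf (j + 1) b.src = z → iterBlockOf (j + 1) b.tgt = z → Near b)
    (hchartNear : ∀ b, Near b → ((GaugeField.gaugeAct uS Umin b : Matrix.specialUnitaryGroup (Fin 2) ℂ) : Matrix (Fin 2) (Fin 2) ℂ) =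
      exp ((Complex.I * ((((F.L : ℝ))⁻¹ ^ (K - n) : ℝ) : ℂ)) • (A - H (D A)) b))
    (Wl : ℝ → GaugeField (F.P K) 0 (Matrix.specialUnitaryGroup (Fin 2) ℂ))
    (hWnear : ∀ t : ℝ, |t| < r → ∀ b, Near b → ((Wl t b : Matrix.specialUnitaryGroup (Fin 2) ℂ) : Matrix (Fin 2) (Fin 2) ℂ) =
      exp ((Complex.I * ((((F.L : ℝ))⁻¹ ^ (K - n) : ℝ) : ℂ)) • ((A + t • Y) - H (D (A + t • Y))) b))
    (hWfar : ∀ (t : ℝ) (b : PBond (F.P K) 0), ¬ Near b → Wl t b = GaugeField.gaugeAct uS Umin b) :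
    ∃ r' : ℝ, 0 < r' ∧ ∃ h : ℝ → GaugeTransf (F.P K) 0 (Matrix.specialUnitaryGroup (Fin 2) ℂ),
      (∀ t : ℝ, |t| < r' → GaugeField.gaugeAct (h t) (Wl t) ∈ fibre F ℰp n K hnK V) ∧
      (∀ x : Site (F.P K) 0, DifferentiableAt ℝ (fun t : ℝ => ((h t x : Matrix.specialUnitaryGroup (Fin 2) ℂ) : Matrix (Fin 2) (Fin 2) ℂ)) 0) ∧
      (∀ b : PBond (F.P K) 0, DifferentiableAt ℝ (fun t : ℝ => ((Wl t b : Matrix.specialUnitaryGroup (Fin 2) ℂ) : Matrix (Fin 2) (Fin 2) ℂ)) 0) := by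
  -- file C: the gauge family on the line
  obtain ⟨hl, hfib, hhl, hWd⟩ := exists_smoothGauge_mem_fibre_of_chart49_line F n K Dm hDk hcollar hw hR H D h49 hHinv hball hDd hAS hYQ hrS hnK hε₀ hε hUmin uS Near
    hNearIdx hNearΩ hchartNear Wl hWnear hWfar
  -- the line starts at the minimiser's gauge copy, which is regular; so the line is regular near `0`
  have hr0 : |(0 : ℝ)| < r := by rw [abs_zero]; exact hr
  have hW0 : Wl 0 = GaugeField.gaugeAct uS Umin := by
    funext b
    by_cases hb : Near b
    · apply Subtype.ext
      rw [hWnear 0 hr0 b hb, hchartNear b hb, zero_smul, add_zero]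
    · exact hWfar 0 b hb
  have hreg0 : RegPr F n K ε₀ (Wl 0) := by rw [hW0]; exact regPr_gaugeAct_of_mem_regFibrePr F n K ε₀ hε₀.le hUmin uS
  have hcont : ContinuousAt Wl 0 := continuousAt_of_differentiableAt_bonds Wl (hWd 0 hr0)
  have hev : ∀ᶠ t in 𝓝 (0 : ℝ), RegPr F n K ε₀ (Wl t) := hcont.preimage_mem_nhds ((isOpen_regPr F n K ε₀).mem_nhds hreg0)
  obtain ⟨r', hr', hreg⟩ := Metric.eventually_nhds_iff.1 hev
  refine ⟨min r r', lt_min hr hr', hl, fun t ht => ?_, hhl 0 hr0, hWd 0 hr0⟩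
  have htr : |t| < r := lt_of_lt_of_le ht (min_le_left _ _)
  have htr' : dist t 0 < r' := by rw [Real.dist_0_eq_abs]; exact lt_of_lt_of_le ht (min_le_right _ _)
  exact hfib t htr (hreg htr')

-- heartbeat budget (HOME README rule): a 40-binder signature; budgeted on this declaration only
set_option maxHeartbeats 400000 in
/-- ★★★ **STAT AT THE MINIMISER ⟹ `deriv (t ↦ 𝒲(W_t)) 0 = 0` ALONG EVERY COMPETITOR LINE OF THE CHART** — see the module docstring; binders = ✓file C's + `0 < r` + door v3's
Stat clause at `Umin`. [cite: Balaban1985Variational, (3)-(6) p.278, (44)-(49) p.285, (111) p.294, (150) p.301, (157)-(158) p.302] -/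
theorem deriv_wilsonAction_chartLine_eq_zero_of_stat (Dm : Domains (F.P K)) (hDk : Dm.k = K - n)
    (hcollar : ∀ (i : ℕ) (e : PBond (F.P K) (i + 1)), Dm.LamBond (i + 1) e → ∀ z : Site (F.P K) i, (blockOf z = e.src ∨ blockOf z = e.tgt) → z ∈ Dm.Om i)
    {w : ℕ → PBond (F.P K) 0 → ℝ} (hw : IsLevWeight F n K Dm w)
    {R : ℝ} (hR : 16 * 3800 * ((((F.P K).d + 2) * (F.P K).L : ℕ) : ℝ) ^ 2 * (F.L : ℝ) * R ≤ 1)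
    (H : (BondIdx Dm → Matrix (Fin 2) (Fin 2) ℂ) →ₗ[ℂ] (PBond (F.P K) 0 → Matrix (Fin 2) (Fin 2) ℂ))
    (D : (PBond (F.P K) 0 → Matrix (Fin 2) (Fin 2) ℂ) → (BondIdx Dm → Matrix (Fin 2) (Fin 2) ℂ))
    {r₁ : ℝ}
    (h49 : ∀ X : PBond (F.P K) 0 → Matrix (Fin 2) (Fin 2) ℂ, (∀ b, w 1 b * ‖X b‖ < r₁) → (fun (Z : PBond (F.P K) 0 → Matrix (Fin 2) (Fin 2) ℂ) =>
      chartLogFlat ((((F.L : ℝ))⁻¹) ^ (K - n)) Dm Z - (fderiv ℂ (chartLogFlat ((((F.L : ℝ))⁻¹) ^ (K - n)) Dm : (PBond (F.P K) 0 → Matrix (Fin 2) (Fin 2) ℂ) →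
        BondIdx Dm → Matrix (Fin 2) (Fin 2) ℂ) 0) Z) (X - H (D X)) = D X)
    (hHinv : ∀ Y : BondIdx Dm → Matrix (Fin 2) (Fin 2) ℂ, (fderiv ℂ (chartLogFlat ((((F.L : ℝ))⁻¹) ^ (K - n)) Dm : (PBond (F.P K) 0 → Matrix (Fin 2) (Fin 2) ℂ) →
      BondIdx Dm → Matrix (Fin 2) (Fin 2) ℂ) 0) (H Y) = Y)
    (hball : ∀ X : PBond (F.P K) 0 → Matrix (Fin 2) (Fin 2) ℂ, (∀ b, w 1 b * ‖X b‖ < r₁) → ∀ b, w 1 b * ‖(X - H (D X)) b‖ < R)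
    (hDd : ∀ X : PBond (F.P K) 0 → Matrix (Fin 2) (Fin 2) ℂ, (∀ b, w 1 b * ‖X b‖ < r₁) → DifferentiableAt ℂ D X)
    {A : PBond (F.P K) 0 → Matrix (Fin 2) (Fin 2) ℂ} (hAS : ∀ b, w 1 b * ‖A b‖ < r₁)
    {Y : PBond (F.P K) 0 → Matrix (Fin 2) (Fin 2) ℂ} (hYQ : ∀ c : BondIdx Dm, bondAvgIter (c.1.1 : ℕ) Y c.1.2 = 0)
    {r : ℝ} (hr : 0 < r) (hrS : ∀ t : ℝ, |t| < r → ∀ b, w 1 b * ‖(A + t • Y) b‖ < r₁)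
    (hnK : n ≤ K) {ε₀ : ℝ} (hε₀ : 0 < ε₀) (hε : 10 ^ 7 * (F.L : ℝ) ^ 3 * ε₀ ≤ 1)
    {V : GaugeField (F.P n) 0 (Matrix.specialUnitaryGroup (Fin 2) ℂ)} {Umin : GaugeField (F.P K) 0 (Matrix.specialUnitaryGroup (Fin 2) ℂ)}
    (hUmin : Umin ∈ regFibrePr F n K hnK ε₀ V)
    (hstat : ∀ γ : ℝ → GaugeField (F.P K) 0 (Matrix.specialUnitaryGroup (Fin 2) ℂ), γ 0 = Umin → (∀ t, γ t ∈ fibre F ℰp n K hnK V) →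
      (∀ b, DifferentiableAt ℝ (fun t => ((γ t b : Matrix.specialUnitaryGroup (Fin 2) ℂ) : Matrix (Fin 2) (Fin 2) ℂ)) 0) →
      deriv (fun t => wilsonAction4 (γ t)) 0 = 0)
    (uS : GaugeTransf (F.P K) 0 (Matrix.specialUnitaryGroup (Fin 2) ℂ))
    (Near : PBond (F.P K) 0 → Prop)
    (hNearIdx : ∀ idx : BondIdx Dm, 1 ≤ (idx.1.1 : ℕ) → ∀ b : PBond (F.P K) 0,
      (iterBlockOf (idx.1.1 : ℕ) b.src = idx.1.2.src ∨ iterBlockOf (idx.1.1 : ℕ) b.src = idx.1.2.tgt) →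
      (iterBlockOf (idx.1.1 : ℕ) b.tgt = idx.1.2.src ∨ iterBlockOf (idx.1.1 : ℕ) b.tgt = idx.1.2.tgt) → Near b)
    (hNearΩ : ∀ (j : ℕ) (z : Site (F.P K) (j + 1)), z ∈ Dm.Om (j + 1) → ∀ b : PBond (F.P K) 0, iterBlockOf (j + 1) b.src = z → iterBlockOf (j + 1) b.tgt = z → Near b)
    (hchartNear : ∀ b, Near b → ((GaugeField.gaugeAct uS Umin b : Matrix.specialUnitaryGroup (Fin 2) ℂ) : Matrix (Fin 2) (Fin 2) ℂ) =
      exp ((Complex.I * ((((F.L : ℝ))⁻¹ ^ (K - n) : ℝ) : ℂ)) • (A - H (D A)) b))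
    (Wl : ℝ → GaugeField (F.P K) 0 (Matrix.specialUnitaryGroup (Fin 2) ℂ))
    (hWnear : ∀ t : ℝ, |t| < r → ∀ b, Near b → ((Wl t b : Matrix.specialUnitaryGroup (Fin 2) ℂ) : Matrix (Fin 2) (Fin 2) ℂ) =
      exp ((Complex.I * ((((F.L : ℝ))⁻¹ ^ (K - n) : ℝ) : ℂ)) • ((A + t • Y) - H (D (A + t • Y))) b))
    (hWfar : ∀ (t : ℝ) (b : PBond (F.P K) 0), ¬ Near b → Wl t b = GaugeField.gaugeAct uS Umin b) :
    deriv (fun t : ℝ => wilsonAction4 (Wl t)) 0 = 0 := by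
  obtain ⟨r', hr', h, hfib, hhd, hWd⟩ := exists_gaugeFamily_chartLine F n K Dm hDk hcollar hw hR H D h49 hHinv hball hDd hAS hYQ hr hrS hnK hε₀ hε hUmin uS Near
    hNearIdx hNearΩ hchartNear Wl hWnear hWfar
  have hr0 : |(0 : ℝ)| < r := by rw [abs_zero]; exact hr
  have hW0 : Wl 0 = GaugeField.gaugeAct uS Umin := by
    funext b
    by_cases hb : Near b
    · apply Subtype.ext
      rw [hWnear 0 hr0 b hb, hchartNear b hb, zero_smul, add_zero]
    · exact hWfar 0 b hb
  exact deriv_wilsonAction_line_eq_zero_of_stat hnK V ((mem_regFibrePr_iff F).1 hUmin).1 hstat Wl uS hW0 hWd hr' h hfib hhd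

end Summit.QuantumFields.YangMills.Theorems.HalvingCompetitorMapFibreSmoothStat

end
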